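import Literature.NumberTheory.GaloisRepresentations.AlgebraicHeckeCharacterPurity
import Literature.NumberTheory.GaloisRepresentations.HeckeCharacterValueFieldProofs
import Mathlib.NumberTheory.NumberField.Norm
import HarnessLib

/-!
# The absolute values of an algebraic Hecke character: `|χ̃(𝔞)|² = N𝔞^w` (Weil; proofs)

Topic `NumberTheory/GaloisRepresentations`; namespace `Literature.NumberTheory.GaloisRepresentations`.
Proof file (theorems only: no definition, no named fact, no instance). Let `χ` be a Hecke character
of the number field `K` of infinity type `(p, q)` (`HeckeCharacter.HasInfinityType`) with module of
definition `(T, e)` (`HeckeCharacter.IsModulus`, `𝔪 = ∏_{v ∈ T} 𝔭_v^{e_v+1}`), let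
`χ̃(𝔞) = ∏_𝔭 χ(ϖ_𝔭)^{v_𝔭(𝔞)}` be its Größencharakter (`LFunctions.idealPow` of `v ↦ χ(ϖ_v)`), and let
`w` be its weight (`2(p_v + q_v) = w [K_v : ℝ]` at every infinite place, which holds by purity,
`HasInfinityType.exists_two_mul_add_eq_weight_mul_mult` of `AlgebraicHeckeCharacterPurity`). This
file proves:

* `norm_prod_embedding_zpow_sq_eq_norm_zpow` —
  `|∏_w σ_w(x)^{p_w} \overline{σ_w(x)}^{q_w}|² = |N_{K/ℚ}(x)|^w` (Mathlib `prod_eq_abs_norm`: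
  `∏_w |x|_w^{[K_w:ℝ]} = |N(x)|`);
* `HasInfinityType.norm_idealPow_sq` — **`|χ̃(𝔞)|² = N𝔞^w`** for every nonzero `𝔞` prime to `𝔪`:
  some power `𝔞^m`, `m ≥ 1`, lies in the trivial narrow ray class, `(c) 𝔞^m = (b)`
  (`exists_pos_rayClassRel_top_pow`, `HeckeCharacterValueFieldProofs`), where
  `χ̃(𝔞)^m = ∏_w σ_w(b/c)^{p_w} \overline{σ_w(b/c)}^{q_w}` (`idealPow_pow_eq_archRatio`), so
  `|χ̃(𝔞)|^{2m} = |N(b/c)|^w = N𝔞^{m w}`;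
* `HasInfinityType.norm_valueAtUniformizer_sq` — in particular **`|χ(ϖ_v)|² = Nv^w` off `T`**.

This is the classical statement that an algebraic Hecke character of weight `w` is unitary after the
twist by `|·|^{w/2}` (Weil 1956; Patrikis 2019, §2.1: "Any such `ψ` is the twist by `|·|^r` … of a
unitary Hecke character", with `r = -w/2` for type `A₀` of weight `w`), in the ideal-theoretic form
needed for the CM-or-totally-real property of the field of values (`|t|² = |σ t|²` for all
`σ ∈ Aut(ℂ)`).

## References

* A. Weil, *On a certain type of characters of the idèle-class group of an algebraic
  number-field* (1956). [Weil1956]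
* S. Patrikis, *Variations on a theorem of Tate*, Mem. AMS 258 (2019) = arXiv:1207.6724, §2.1.
  [Patrikis2019]
* J. Neukirch, *Algebraic Number Theory* (1999), Ch. VI §1 (1.8), Ch. VII §6 (6.13)–(6.14).
  [NeukirchANT1999]
-/

noncomputable section

open scoped NumberField ComplexConjugate Classical
open NumberField IsDedekindDomain NumberField.InfinitePlace

namespace Literature.NumberTheory.GaloisRepresentations

universe u

variable {K : Type u} [Field K] [NumberField K]

namespace HeckeCharacter

variable {χ : HeckeCharacter K} {p q : InfinitePlace K → ℤ}
  {T : Finset (HeightOneSpectrum (𝓞 K))} {e : HeightOneSpectrum (𝓞 K) → ℕ}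

/-! ### §1. Absolute values of archimedean monomials -/

omit [NumberField K] in
/-- `|∏_w σ_w(x)^{p_w} \overline{σ_w(x)}^{q_w}|² = ∏_w |x|_w^{2(p_w+q_w)}`. [folklore] -/
theorem norm_prod_embedding_zpow_sq [NumberField K] (p q : InfinitePlace K → ℤ) {x : K} (hx : x ≠ 0) :
    ‖∏ w : InfinitePlace K, w.embedding x ^ (p w) * conj (w.embedding x) ^ (q w)‖ ^ 2 =
      ∏ w : InfinitePlace K, (w x) ^ (2 * (p w + q w)) := by
  rw [norm_prod, ← Finset.prod_pow]
  refine Finset.prod_congr rfl fun w _ ↦ ?_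
  have hw : (w x) ≠ 0 := (pos_iff.mpr hx).ne'
  rw [norm_mul, norm_zpow, norm_zpow, Complex.norm_conj, norm_embedding_eq, ← zpow_add₀ hw,
    ← zpow_natCast, ← zpow_mul, mul_comm, Nat.cast_ofNat]

/-- With the weight relation `2(p_v + q_v) = w [K_v : ℝ]`:
`|∏_w σ_w(x)^{p_w} \overline{σ_w(x)}^{q_w}|² = |N_{K/ℚ}(x)|^w` (`∏_w |x|_w^{[K_w:ℝ]} = |N(x)|`,
Mathlib `prod_eq_abs_norm`). [folklore] -/
theorem norm_prod_embedding_zpow_sq_eq_norm_zpow (p q : InfinitePlace K → ℤ) {wt : ℤ}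
    (hw : ∀ v : InfinitePlace K, 2 * (p v + q v) = wt * v.mult) {x : K} (hx : x ≠ 0) :
    ‖∏ w : InfinitePlace K, w.embedding x ^ (p w) * conj (w.embedding x) ^ (q w)‖ ^ 2 =
      (|(Algebra.norm ℚ x : ℝ)|) ^ wt := by
  rw [norm_prod_embedding_zpow_sq p q hx]
  have h1 : ∀ w : InfinitePlace K, (w x) ^ (2 * (p w + q w)) = ((w x) ^ w.mult) ^ wt := by
    intro w
    rw [hw w, ← zpow_natCast, ← zpow_mul, mul_comm]
  simp_rw [h1]
  rw [Finset.prod_zpow, prod_eq_abs_norm, Rat.cast_abs]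

/-! ### §2. `|χ̃(𝔞)|² = N𝔞^w` -/

/-- A prime `𝔭_v` with `v ∉ T` is prime to the module of definition `𝔪 = ∏_{v ∈ T} 𝔭_v^{e_v+1}`.
[folklore] -/
theorem isCoprime_asIdeal_modulusIdeal {v : HeightOneSpectrum (𝓞 K)} (hv : v ∉ T) :
    IsCoprime v.asIdeal (modulusIdeal T e) := by
  have hle : ¬ modulusIdeal T e ≤ v.asIdeal := fun h ↦ hv (modulusIdeal_le_iff.mp h)
  rw [Ideal.isCoprime_iff_sup_eq]
  by_contra hne
  exact hle (le_sup_right.trans (v.isMaximal.eq_of_le hne le_sup_left).ge)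

/-- **The absolute values of the Größencharakter of an algebraic Hecke character**: if `χ` has
infinity type `(p, q)` of weight `w` (`2(p_v + q_v) = w [K_v : ℝ]`,
`HasInfinityType.exists_two_mul_add_eq_weight_mul_mult`) and module of definition `(T, e)`, then
`|χ̃(𝔞)|² = N𝔞^w` for every nonzero `𝔞` prime to `𝔪`: `χ̃(𝔞)^m` is an archimedean monomial in
`b/c` with `(c) 𝔞^m = (b)` (`exists_pos_rayClassRel_top_pow`, `idealPow_pow_eq_archRatio`), so
`|χ̃(𝔞)|^{2m} = |N(b/c)|^w = N𝔞^{m w}`. (Weil 1956: `χ |·|^{-w/2}` is unitary; Patrikis 2019, §2.1.)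
[cite: Weil1956] [cite: Patrikis2019, §2.1 (arXiv:1207.6724)] -/
theorem HasInfinityType.norm_idealPow_sq (hinf : χ.HasInfinityType p q) (hmod : IsModulus χ T e)
    {wt : ℤ} (hw : ∀ v : InfinitePlace K, 2 * (p v + q v) = wt * v.mult)
    {𝔞 : Ideal (𝓞 K)} (h0 : 𝔞 ≠ ⊥) (hcop : IsCoprime 𝔞 (modulusIdeal T e)) :
    ‖LFunctions.idealPow K (fun v ↦ χ.valueAtUniformizer v) 𝔞‖ ^ 2 = ((Ideal.absNorm 𝔞 : ℝ)) ^ wt := by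
  obtain ⟨N, hN, b, c, hb, hc, hcop', hbc, hpos, heq⟩ :=
    exists_pos_rayClassRel_top_pow (modulusIdeal_ne_bot T e) h0 hcop
  have hval := hinf.idealPow_pow_eq_archRatio hmod h0 hb hc hcop' hbc hpos heq
  have hb' : (b : K) ≠ 0 := by exact_mod_cast hb
  have hc' : (c : K) ≠ 0 := by exact_mod_cast hc
  have hx : (b : K) / c ≠ 0 := div_ne_zero hb' hc'
  -- norms of the ideals: `N((c)) N𝔞^N = N((b))`
  have hNa : (Ideal.absNorm 𝔞 : ℝ) ≠ 0 := by
    exact_mod_cast (Ideal.absNorm_eq_zero_iff.not.mpr (by rwa [← Submodule.zero_eq_bot] at h0))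
  have hNa0 : 0 ≤ (Ideal.absNorm 𝔞 : ℝ) := Nat.cast_nonneg _
  have hnormZ : (Ideal.absNorm (Ideal.span {c}) : ℝ) * (Ideal.absNorm 𝔞 : ℝ) ^ N =
      (Ideal.absNorm (Ideal.span {b}) : ℝ) := by
    have := congrArg Ideal.absNorm heq
    rw [Ideal.mul_top, map_mul, map_pow] at this
    exact_mod_cast this
  have habs : ∀ d : 𝓞 K, (Ideal.absNorm (Ideal.span {d}) : ℝ) = |(Algebra.norm ℚ (d : K) : ℝ)| := by
    intro d
    rw [Ideal.absNorm_span_singleton, Nat.cast_natAbs, Int.cast_abs, ← Algebra.coe_norm_int,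
      Rat.cast_intCast]
  have hNc : (Algebra.norm ℚ (c : K) : ℝ) ≠ 0 := by
    exact_mod_cast Algebra.norm_ne_zero_iff.mpr hc'
  -- `|N(b/c)| = N𝔞^N`
  have hnormx : |(Algebra.norm ℚ ((b : K) / c) : ℝ)| = (Ideal.absNorm 𝔞 : ℝ) ^ N := by
    have hmul : Algebra.norm ℚ ((b : K) / c) * Algebra.norm ℚ (c : K) = Algebra.norm ℚ (b : K) := by
      rw [← map_mul, div_mul_cancel₀ _ hc']
    have h1 : |(Algebra.norm ℚ ((b : K) / c) : ℝ)| * (Ideal.absNorm (Ideal.span {c}) : ℝ) =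
        (Ideal.absNorm (Ideal.span {b}) : ℝ) := by
      rw [habs b, habs c, ← abs_mul]
      congr 1
      exact_mod_cast hmul
    have hc0 : (Ideal.absNorm (Ideal.span {c}) : ℝ) ≠ 0 := by
      rw [habs c]
      exact abs_ne_zero.mpr hNc
    refine mul_right_cancel₀ hc0 ?_
    rw [h1, ← hnormZ, mul_comm]
  -- `|χ̃(𝔞)|^{2N} = |N(b/c)|^w = N𝔞^{N w}`
  have hsq := norm_prod_embedding_zpow_sq_eq_norm_zpow p q hw hx
  have hR : (|(Algebra.norm ℚ ((b : K) / c) : ℝ)|) ^ wt = ((Ideal.absNorm 𝔞 : ℝ) ^ wt) ^ N := by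
    rw [hnormx]
    calc ((Ideal.absNorm 𝔞 : ℝ) ^ N) ^ wt = ((Ideal.absNorm 𝔞 : ℝ) ^ (N : ℤ)) ^ wt := by
          rw [zpow_natCast]
      _ = (Ideal.absNorm 𝔞 : ℝ) ^ ((N : ℤ) * wt) := (zpow_mul _ _ _).symm
      _ = (Ideal.absNorm 𝔞 : ℝ) ^ (wt * N) := by rw [mul_comm]
      _ = ((Ideal.absNorm 𝔞 : ℝ) ^ wt) ^ (N : ℤ) := zpow_mul _ _ _
      _ = ((Ideal.absNorm 𝔞 : ℝ) ^ wt) ^ N := zpow_natCast _ _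
  have hL : ‖∏ w : InfinitePlace K, w.embedding ((b : K) / c) ^ (p w) *
      conj (w.embedding ((b : K) / c)) ^ (q w)‖ ^ 2 =
      (‖LFunctions.idealPow K (fun v ↦ χ.valueAtUniformizer v) 𝔞‖ ^ 2) ^ N := by
    rw [← hval, norm_pow, ← pow_mul, mul_comm, pow_mul]
  have hsq' : (‖LFunctions.idealPow K (fun v ↦ χ.valueAtUniformizer v) 𝔞‖ ^ 2) ^ N =
      ((Ideal.absNorm 𝔞 : ℝ) ^ wt) ^ N := by
    rw [← hL, hsq, hR]
  -- extract `N`-th roots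
  have hl : 0 ≤ ‖LFunctions.idealPow K (fun v ↦ χ.valueAtUniformizer v) 𝔞‖ ^ 2 := by positivity
  have hr : 0 ≤ (Ideal.absNorm 𝔞 : ℝ) ^ wt := zpow_nonneg hNa0 _
  exact (pow_left_inj₀ hl hr hN.ne').mp hsq'

/-- **`|χ(ϖ_v)|² = Nv^w` off `T`** for a Hecke character of infinity type `(p, q)` of weight `w` and
module of definition `(T, e)`. (Weil 1956; Patrikis 2019, §2.1: `χ` is unitary up to `|·|^{w/2}`.)
[cite: Weil1956] [cite: Patrikis2019, §2.1 (arXiv:1207.6724)] -/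
theorem HasInfinityType.norm_valueAtUniformizer_sq (hinf : χ.HasInfinityType p q) (hmod : IsModulus χ T e)
    {wt : ℤ} (hw : ∀ v : InfinitePlace K, 2 * (p v + q v) = wt * v.mult)
    {v : HeightOneSpectrum (𝓞 K)} (hv : v ∉ T) :
    ‖χ.valueAtUniformizer v‖ ^ 2 = ((Ideal.absNorm v.asIdeal : ℝ)) ^ wt := by
  have h := hinf.norm_idealPow_sq hmod hw v.ne_bot (isCoprime_asIdeal_modulusIdeal hv)
  rwa [LFunctions.idealPow_asIdeal] at h

/-- **The values `χ(ϖ_v)` off `T` lie in a number field**, in the form indexed by the module of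
definition (from `HasInfinityType.exists_intermediateField_idealPow_mem` of
`HeckeCharacterValueFieldProofs`, Weil 1956; Patrikis 2019, Lemma 2.1.2).
[cite: Weil1956, §1] [cite: Patrikis2019, Lemma 2.1.2 (arXiv:1207.6724 §2.1)] -/
theorem HasInfinityType.exists_intermediateField_valueAtUniformizer_mem_of_not_mem
    (hinf : χ.HasInfinityType p q) (hmod : IsModulus χ T e) :
    ∃ E : IntermediateField ℚ ℂ, FiniteDimensional ℚ E ∧
      ∀ v : HeightOneSpectrum (𝓞 K), v ∉ T → χ.valueAtUniformizer v ∈ E := by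
  obtain ⟨E, hE, -, hmem⟩ := hinf.exists_intermediateField_idealPow_mem hmod
  refine ⟨E, hE, fun v hv ↦ ?_⟩
  have h := hmem v.asIdeal v.ne_bot (isCoprime_asIdeal_modulusIdeal hv)
  rwa [LFunctions.idealPow_asIdeal] at h

end HeckeCharacter

end Literature.NumberTheory.GaloisRepresentations
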